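import Literature.AlgebraicGeometry.HodgeTheory.BettiKunnethPieceCorrespondenceActionSurjective
import HarnessLib

/-!
# The Künneth piece `Hⁱ(Y;ℂ) ⊗ Hʲ(Z;ℂ) ⊂ Hᵏ(Y × Z;ℂ)` is defined over `ℚ`: it is the `ℂ`-span of the rational summand `Hⁱ(Y;ℚ) ⊗ Hʲ(Z;ℚ)` (Künneth theorem with `ℚ`-coefficients), `dim_ℂ = b_i(Y) b_j(Z)` in
# every total degree, its rational classes are the classes of the summand, and the actions of the rational summand span `Hom_ℂ(H^{2n−j}(Z;ℂ), Hⁱ(Y;ℂ))`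
# (Voisin I §7.1.1, §11.3.3 Thm. 11.38, Lemma 11.41, pp. 285–287; Hatcher Thm. 3.2, Thm. 3.15, Thm. 3.16, Cor. 3A.6)

Family `hodge`, lane `lit-hodgefound` (Track 2 foundations library; Layers A1/A4), layer `Literature/AlgebraicGeometry/HodgeTheory`.  THEOREMS ONLY (no definition, no named fact, no instance;
D-0026 net debt `0`).  The tree has the rational Künneth theorem (`BettiUniverse.kunnethMap_bijective`: `⊕_{i+j=k} Hⁱ(Y;ℚ) ⊗ Hʲ(Z;ℚ) ≅ Hᵏ(Y × Z;ℚ)`), the complex Künneth PIECES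
`kunnethPiece Y Z (i + j = k) = span_ℂ {pr_Y^* a ∪ pr_Z^* b}` of `Hᵏ(Y × Z;ℂ)`, the compatibility `(crossMap t) ⊗ 1 ∈ kunnethPiece` and the rationality of the Künneth components of a rational class
(`kunnethComponent_eq_ofRatClass_crossMap`).  This file records the `ℚ`-structure of one piece: §1 ℚ-linearly independent classes of the summand `Hⁱ(Y;ℚ) ⊗ Hʲ(Z;ℚ)` have ℂ-linearly independent
images `crossMap t ⊗ 1` (rational classes: `ℚ`-independence is `ℂ`-independence); §2 **the piece IS the `ℂ`-span of these images** (bilinearity of `∪` over the rational bases of `Hⁱ(Y;ℚ)`, `Hʲ(Z;ℚ)`,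
whose images span `Hⁱ(Y;ℂ)`, `Hʲ(Z;ℂ)`), hence **`dim_ℂ kunnethPiece = b_i(Y) · b_j(Z)` in EVERY total degree `k`** (the seat's g30-#9 had it for even `k` through the correspondence action); §3 a RATIONAL
class lying in one piece is `crossMap t ⊗ 1` for a (unique) `t` in the summand; §4 for `k = 2c` and `a + j = 2 dim Z` the actions `(crossMap t ⊗ 1)_* : Hᵃ(Z;ℂ) → Hⁱ(Y;ℂ)` of the rational summand
span `Hom_ℂ(Hᵃ(Z;ℂ), Hⁱ(Y;ℂ))` over `ℂ` and `dim_ℚ (Hⁱ(Y;ℚ) ⊗ Hʲ(Z;ℚ)) = dim_ℂ Hom_ℂ(Hᵃ(Z;ℂ), Hⁱ(Y;ℂ))` — with the injectivity of the seat's g30-#2 (`BettiUniverse.corrAction_crossMap_injective`,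
`…linearIndependent_corrAction_crossMap`): **`Hⁱ(Y;ℚ) ⊗ Hʲ(Z;ℚ)` is a `ℚ`-form of `Hom_ℂ(H^{2n−j}(Z;ℂ), Hⁱ(Y;ℂ))` under `t ↦ (crossMap t ⊗ 1)_*`**, the carrier statement behind Lemma 11.41.

WHAT IS PROVED.
* §1 **`BettiUniverse.linearIndependent_ofRatClass_crossMap`**.
* §2 **`BettiUniverse.kunnethPiece_eq_span_range_ofRatClass_crossMap`** (all `k`), **`finrank_kunnethPiece_eq_of_add_eq`** (`dim_ℂ kunnethPiece Y Z (i + j = k) = b_i(Y) b_j(Z)`, all `k`),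
  **`BettiUniverse.finrank_kunnethPiece_eq_finrank_tensor`** (`= dim_ℚ (Hⁱ(Y;ℚ) ⊗ Hʲ(Z;ℚ))`).
* §3 **`BettiUniverse.exists_eq_ofRatClass_crossMap_of_isRationalClass`**, **`BettiUniverse.existsUnique_eq_ofRatClass_crossMap_of_isRationalClass`** (rational classes of a piece).
* §4 (`k = 2c`, `a + j = 2 dim Z`) **`BettiUniverse.span_range_corrAction_ofRatClass_crossMap_eq_top`**, **`BettiUniverse.finrank_tensor_eq_finrank_hom_complexBetti`**.

THE PRINTS.  C. Voisin (2002) [VoisinHodgeI2002] §7.1.1; §11.3.3 Thm. 11.38, Lemma 11.41 and pp. 285–287.  A. Hatcher (2002) [HatcherAT2002] §3.1 Thm. 3.2 and p. 198; §3.2 Thm. 3.15, Thm. 3.16; §3.A Cor. 3A.6.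

THE OBJECTS (all the tree's).  `kunnethPiece Y Z h`, `BettiUniverse.crossMap Y Z h`, `BettiUniverse.kunnethMap`, `BettiUniverse.kunnethMap_bijective`, `ofRatClass`, `IsRationalClass`, `cupProduct`, `complexBetti.map (fst Y Z) i`,
`complexBetti.map (snd Y Z) j`, `corrAction μ hY hZ hab`, `bettiCohomology`, `complexBetti`; `kunnethComponent_eq_ofRatClass_crossMap`, `ofRatClass_crossMap_mem_kunnethPiece`, `BettiUniverse.ofRatClass_crossMap_tmul`,
`mem_span_range_ofRatClass_basis`, `linearIndependent_of_isRationalClass`, the seat's g30-#9 `map_corrAction_kunnethPiece_eq_top`, `finrank_hom_complexBetti_eq_finrank_kunnethPiece`.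

DEVIATIONS / SCOPE.  Carriers only; no Hodge-structure statement.  No definitions.

## References
* [VoisinHodgeI2002] C. Voisin, *Hodge Theory and Complex Algebraic Geometry I* (2002) — §7.1.1; §11.3.3 Thm. 11.38, Lemma 11.41, pp. 285–287.
* [HatcherAT2002] A. Hatcher, *Algebraic Topology* (2002) — §3.1 Thm. 3.2, p. 198; §3.2 Thm. 3.15, Thm. 3.16; §3.A Cor. 3A.6.

## Provenance
Lane `lit-hodgefound` (Hodge path, Track 2), prover seat `lit-hodgefound-p29` (generation 30), self-proposed row g30-#11 (the `ℚ`-structure of the Künneth piece; complements g30-#2/#9).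
-/

noncomputable section

open scoped TensorProduct
open CategoryTheory MonoidalCategory CartesianMonoidalCategory Module Finset
open Literature.AlgebraicTopology.SingularHomology
open Literature.Geometry.Kaehler

namespace Literature.AlgebraicGeometry.HodgeTheory

open Literature.AlgebraicGeometry.Motives
open Literature.AlgebraicGeometry.Motives.HodgeStructure

variable {m n : ℕ} {X Y Z : SchemeOver ℂ}

/-! ### §0 Plumbing -/

/-- `(q • a) ⊗ 1 = q • (a ⊗ 1)` for the lattice map `Hᵏ(T;ℚ) → Hᵏ(T;ℂ)` (private copy of a file-local tree lemma). [cite: HatcherAT2002, §3.1 p. 198] -/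
private theorem ofRatClass_rat_smul'' {T : Type} [TopologicalSpace T] {k : ℕ} (q : ℚ) (a : singularCohomology ℚ ℚ T k) :
    ofRatClass T k (q • a) = (q : ℂ) • ofRatClass T k a := by
  rw [ofRatClass, coeffClass_smul, smul_coeffClass]
  refine coeffClass_congr (fun x ↦ ?_) a
  simp

/-! ### §1 `ℚ`-independent classes of the summand are `ℂ`-independent in `Hᵏ(Y × Z;ℂ)` -/

/-- **ℚ-linearly independent classes `t_p ∈ Hⁱ(Y;ℚ) ⊗ Hʲ(Z;ℚ)` have ℂ-linearly independent images `crossMap t_p ⊗ 1 ∈ Hᵏ(Y × Z;ℂ)`** (`crossMap` is injective — one summand of the rational Künneth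
isomorphism — and rational classes that are ℚ-independent are ℂ-independent). [cite: VoisinHodgeI2002, §7.1.1, §11.3.3 Thm. 11.38] [cite: HatcherAT2002, §3.1 p. 198 and §3.2 Thm. 3.15] -/
theorem BettiUniverse.linearIndependent_ofRatClass_crossMap {ι : Type} [Fintype ι] (hY : IsSmoothProjective m Y) (hZ : IsSmoothProjective n Z) {i j k : ℕ} (h : i + j = k)
    {t : ι → bettiCohomology Y i ⊗[ℚ] bettiCohomology Z j} (ht : LinearIndependent ℚ t) :
    LinearIndependent ℂ fun p ↦ ofRatClass (ComplexPoints (Y ⊗ Z)) k (BettiUniverse.crossMap Y Z h (t p)) := by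
  classical
  refine linearIndependent_of_isRationalClass (fun p ↦ isRationalClass_ofRatClass _) fun q hq ↦ ?_
  have h1 : ofRatClass (ComplexPoints (Y ⊗ Z)) k (BettiUniverse.crossMap Y Z h (∑ p, q p • t p)) = 0 := by
    rw [map_sum, map_sum]
    simpa only [map_smul, ofRatClass_rat_smul''] using hq
  have h2 : ∑ p, q p • t p = 0 :=
    BettiUniverse.crossMap_injective hY hZ h (ofRatClass_injective (Y := ComplexPoints (Y ⊗ Z)) k (by rw [h1, map_zero, map_zero]))
  funext p
  exact Fintype.linearIndependent_iff.1 ht q h2 p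

/-! ### §2 The piece is the `ℂ`-span of the rational summand; its dimension -/

/-- **`kunnethPiece Y Z (i + j = k) = span_ℂ {crossMap t ⊗ 1 : t ∈ Hⁱ(Y;ℚ) ⊗ Hʲ(Z;ℚ)}`**: `⊇` since `crossMap (y ⊗ z) ⊗ 1 = pr_Y^*(y ⊗ 1) ∪ pr_Z^*(z ⊗ 1)`; `⊆` by bilinearity of `pr_Y^* a ∪ pr_Z^* b` in `(a, b)`, the
rational classes `y ⊗ 1`, `z ⊗ 1` spanning `Hⁱ(Y;ℂ)`, `Hʲ(Z;ℂ)` over `ℂ`. [cite: VoisinHodgeI2002, §7.1.1, §11.3.3 Thm. 11.38 and p. 285] [cite: HatcherAT2002, §3.2 Thm. 3.15, Thm. 3.16 and §3.A Cor. 3A.6] -/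
theorem BettiUniverse.kunnethPiece_eq_span_range_ofRatClass_crossMap (hY : IsSmoothProjective m Y) (hZ : IsSmoothProjective n Z) {i j k : ℕ} (h : i + j = k) :
    kunnethPiece Y Z h = Submodule.span ℂ (Set.range fun t : bettiCohomology Y i ⊗[ℚ] bettiCohomology Z j ↦ ofRatClass (ComplexPoints (Y ⊗ Z)) k (BettiUniverse.crossMap Y Z h t)) := by
  classical
  haveI := BettiUniverse.finite hY i
  haveI := BettiUniverse.finite hZ j
  set S := Submodule.span ℂ (Set.range fun t : bettiCohomology Y i ⊗[ℚ] bettiCohomology Z j ↦ ofRatClass (ComplexPoints (Y ⊗ Z)) k (BettiUniverse.crossMap Y Z h t)) with hS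
  refine le_antisymm ?_ (Submodule.span_le.2 ?_)
  · -- step A: `pr_Y^* a ∪ pr_Z^*(z ⊗ 1) ∈ S` for every `a ∈ Hⁱ(Y;ℂ)` and rational `z`
    have hA : ∀ (z : bettiCohomology Z j) (a : complexBetti Y i),
        cupProduct h (complexBetti.map (fst Y Z) i a) (complexBetti.map (snd Y Z) j (ofRatClass (ComplexPoints Z) j z)) ∈ S := by
      intro z a
      have ha := mem_span_range_ofRatClass_basis hY (Module.finBasis ℚ (bettiCohomology Y i)) (y := a)
      induction ha using Submodule.span_induction with
      | mem x hx =>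
        obtain ⟨p, rfl⟩ := hx
        rw [← BettiUniverse.ofRatClass_crossMap_tmul]
        exact Submodule.subset_span ⟨_, rfl⟩
      | zero => rw [map_zero, map_zero, LinearMap.zero_apply]; exact Submodule.zero_mem _
      | add x y _ _ hx hy => rw [map_add, map_add, LinearMap.add_apply]; exact Submodule.add_mem _ hx hy
      | smul c x _ hx => rw [map_smul, map_smul, LinearMap.smul_apply]; exact Submodule.smul_mem _ _ hx
    -- step B: `pr_Y^* a ∪ pr_Z^* b ∈ S` for all `a`, `b`
    refine Submodule.span_le.2 ?_
    rintro _ ⟨a, b, rfl⟩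
    have hb := mem_span_range_ofRatClass_basis hZ (Module.finBasis ℚ (bettiCohomology Z j)) (y := b)
    induction hb using Submodule.span_induction with
    | mem x hx =>
      obtain ⟨p, rfl⟩ := hx
      exact hA _ a
    | zero => rw [map_zero, map_zero]; exact Submodule.zero_mem _
    | add x y _ _ hx hy => rw [map_add, map_add]; exact Submodule.add_mem _ hx hy
    | smul c x _ hx => rw [map_smul, map_smul]; exact Submodule.smul_mem _ _ hx
  · rintro _ ⟨t, rfl⟩
    exact ofRatClass_crossMap_mem_kunnethPiece h t

/-- **`dim_ℂ kunnethPiece Y Z (i + j = k) = b_i(Y) · b_j(Z)` in EVERY total degree `k`**: the piece is the ℂ-span of the images `crossMap β_p ⊗ 1` of a ℚ-basis `(β_p)` of `Hⁱ(Y;ℚ) ⊗ Hʲ(Z;ℚ)` (§2),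
which are ℂ-independent (§1). [cite: VoisinHodgeI2002, §11.3.3 Thm. 11.38 and p. 285] [cite: HatcherAT2002, §3.2 Thm. 3.15, Thm. 3.16 and §3.A Cor. 3A.6] -/
theorem finrank_kunnethPiece_eq_of_add_eq (hY : IsSmoothProjective m Y) (hZ : IsSmoothProjective n Z) {i j k : ℕ} (h : i + j = k) :
    Module.finrank ℂ ↥(kunnethPiece Y Z h) = Module.finrank ℚ (bettiCohomology Y i) * Module.finrank ℚ (bettiCohomology Z j) := by
  classical
  haveI := BettiUniverse.finite hY i
  haveI := BettiUniverse.finite hZ j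
  let β := Module.finBasis ℚ (bettiCohomology Y i ⊗[ℚ] bettiCohomology Z j)
  have hind := BettiUniverse.linearIndependent_ofRatClass_crossMap hY hZ h β.linearIndependent
  have hspan : kunnethPiece Y Z h = Submodule.span ℂ (Set.range fun p ↦ ofRatClass (ComplexPoints (Y ⊗ Z)) k (BettiUniverse.crossMap Y Z h (β p))) := by
    rw [BettiUniverse.kunnethPiece_eq_span_range_ofRatClass_crossMap hY hZ h]
    refine le_antisymm (Submodule.span_le.2 ?_) (Submodule.span_mono ?_)
    · rintro _ ⟨t, rfl⟩
      dsimp only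
      rw [← β.sum_repr t, map_sum, map_sum]
      refine Submodule.sum_mem _ fun p _ ↦ ?_
      rw [map_smul, ofRatClass_rat_smul'']
      exact Submodule.smul_mem _ _ (Submodule.subset_span ⟨p, rfl⟩)
    · rintro _ ⟨p, rfl⟩
      exact ⟨β p, rfl⟩
  rw [hspan, finrank_span_eq_card hind, Fintype.card_fin, Module.finrank_tensorProduct]

/-- **`dim_ℂ kunnethPiece Y Z (i + j = k) = dim_ℚ (Hⁱ(Y;ℚ) ⊗ Hʲ(Z;ℚ))`**. [cite: VoisinHodgeI2002, §11.3.3 Thm. 11.38] [cite: HatcherAT2002, §3.2 Thm. 3.15 and §3.A Cor. 3A.6] -/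
theorem BettiUniverse.finrank_kunnethPiece_eq_finrank_tensor (hY : IsSmoothProjective m Y) (hZ : IsSmoothProjective n Z) {i j k : ℕ} (h : i + j = k) :
    Module.finrank ℂ ↥(kunnethPiece Y Z h) = Module.finrank ℚ (bettiCohomology Y i ⊗[ℚ] bettiCohomology Z j) := by
  haveI := BettiUniverse.finite hY i
  haveI := BettiUniverse.finite hZ j
  rw [finrank_kunnethPiece_eq_of_add_eq hY hZ h, Module.finrank_tensorProduct]

/-! ### §3 The rational classes of a piece -/

/-- **A RATIONAL class lying in the Künneth piece `Hⁱ(Y;ℂ) ⊗ Hʲ(Z;ℂ)` is `crossMap t ⊗ 1` for some `t ∈ Hⁱ(Y;ℚ) ⊗ Hʲ(Z;ℚ)`** (the rational Künneth isomorphism and the uniqueness of Künneth components: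
the tree's `kunnethComponent_eq_ofRatClass_crossMap` applied to the decomposition concentrated in bidegree `(i, j)`). [cite: VoisinHodgeI2002, §11.3.3 Thm. 11.38] [cite: HatcherAT2002, §3.2 Thm. 3.16 and §3.1 p. 198] -/
theorem BettiUniverse.exists_eq_ofRatClass_crossMap_of_isRationalClass (hY : IsSmoothProjective m Y) (hZ : IsSmoothProjective n Z) {i j k : ℕ} (h : i + j = k) {γ : complexBetti (Y ⊗ Z) k}
    (hγ : γ ∈ kunnethPiece Y Z h) (hrat : IsRationalClass γ) :
    ∃ t : bettiCohomology Y i ⊗[ℚ] bettiCohomology Z j, γ = ofRatClass (ComplexPoints (Y ⊗ Z)) k (BettiUniverse.crossMap Y Z h t) := by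
  classical
  obtain rfl : i = k - j := by omega
  -- the decomposition of `γ` concentrated in bidegree `(k - j, j)`
  let j₀ : Fin (k + 1) := ⟨j, by omega⟩
  let π : Fin (k + 1) → complexBetti (Y ⊗ Z) k := fun j' ↦ if j' = j₀ then γ else 0
  have hπ : ∀ j' : Fin (k + 1), π j' ∈ kunnethPiece Y Z (show (k - (j' : ℕ)) + j' = k by omega) := by
    intro j'
    by_cases hj' : j' = j₀
    · subst hj'
      simp only [π, if_pos rfl]
      exact hγ
    · simp only [π, if_neg hj']
      exact Submodule.zero_mem _
  obtain ⟨z, hz⟩ := (isRationalClass_iff_mem_range_ofRatClass γ).1 hrat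
  obtain ⟨t, ht⟩ := (BettiUniverse.kunnethMap_bijective hY hZ k).2 z
  have hsum : ∑ j', π j' = ofRatClass (ComplexPoints (Y ⊗ Z)) k (BettiUniverse.kunnethMap Y Z k t) := by
    rw [ht, hz, Finset.sum_eq_single j₀ (fun j' _ hne ↦ if_neg hne) (fun hn ↦ (hn (Finset.mem_univ _)).elim)]
    exact if_pos rfl
  refine ⟨t ⟨((k - j), j), mem_antidiagonal.2 (by omega)⟩, ?_⟩
  have hcomp := kunnethComponent_eq_ofRatClass_crossMap hY hZ k hπ t hsum j₀
  simpa only [π, if_pos rfl] using hcomp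

/-- **… and `t` is unique** (`crossMap` and `⊗ 1` are injective). [cite: VoisinHodgeI2002, §11.3.3 Thm. 11.38] [cite: HatcherAT2002, §3.2 Thm. 3.16 and §3.1 p. 198] -/
theorem BettiUniverse.existsUnique_eq_ofRatClass_crossMap_of_isRationalClass (hY : IsSmoothProjective m Y) (hZ : IsSmoothProjective n Z) {i j k : ℕ} (h : i + j = k)
    {γ : complexBetti (Y ⊗ Z) k} (hγ : γ ∈ kunnethPiece Y Z h) (hrat : IsRationalClass γ) :
    ∃! t : bettiCohomology Y i ⊗[ℚ] bettiCohomology Z j, γ = ofRatClass (ComplexPoints (Y ⊗ Z)) k (BettiUniverse.crossMap Y Z h t) := by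
  obtain ⟨t, rfl⟩ := BettiUniverse.exists_eq_ofRatClass_crossMap_of_isRationalClass hY hZ h hγ hrat
  refine ⟨t, rfl, fun t' ht' ↦ ?_⟩
  exact (BettiUniverse.crossMap_injective hY hZ h (ofRatClass_injective (Y := ComplexPoints (Y ⊗ Z)) k ht')).symm

/-! ### §4 The rational summand is a `ℚ`-form of `Hom_ℂ(Hᵃ(Z;ℂ), Hⁱ(Y;ℂ))` under the action -/

section Action

variable (μ : OrientationFamily)

/-- **The actions `(crossMap t ⊗ 1)_* : Hᵃ(Z;ℂ) → Hⁱ(Y;ℂ)` of the rational summand `Hⁱ(Y;ℚ) ⊗ Hʲ(Z;ℚ)` span `Hom_ℂ(Hᵃ(Z;ℂ), Hⁱ(Y;ℂ))` over `ℂ`** (`i + j = 2c`, `a + j = 2 dim Z`): their ℂ-span is the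
image of the piece (§2), which is everything (the seat's g30-#9). [cite: VoisinHodgeI2002, §11.3.3 Lemma 11.41 and p. 286] [cite: HatcherAT2002, §3.2 Thm. 3.15 and §3.3 Prop. 3.38] -/
theorem BettiUniverse.span_range_corrAction_ofRatClass_crossMap_eq_top (hY : IsSmoothProjective m Y) (hZ : IsSmoothProjective n Z) {c i j a : ℕ} (hij : i + j = 2 * c)
    (haj : a + j = 2 * n) (hab : a + 2 * c = i + 2 * n) :
    Submodule.span ℂ (Set.range fun t : bettiCohomology Y i ⊗[ℚ] bettiCohomology Z j ↦
      corrAction μ hY hZ hab (ofRatClass (ComplexPoints (Y ⊗ Z)) (2 * c) (BettiUniverse.crossMap Y Z hij t))) = ⊤ := by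
  rw [show (fun t : bettiCohomology Y i ⊗[ℚ] bettiCohomology Z j ↦ corrAction μ hY hZ hab (ofRatClass (ComplexPoints (Y ⊗ Z)) (2 * c) (BettiUniverse.crossMap Y Z hij t))) =
      ⇑(corrAction μ hY hZ hab) ∘ fun t ↦ ofRatClass (ComplexPoints (Y ⊗ Z)) (2 * c) (BettiUniverse.crossMap Y Z hij t) from rfl,
    Set.range_comp, Submodule.span_image, ← BettiUniverse.kunnethPiece_eq_span_range_ofRatClass_crossMap hY hZ hij, map_corrAction_kunnethPiece_eq_top μ hY hZ hij haj hab]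

/-- **`dim_ℚ (Hⁱ(Y;ℚ) ⊗ Hʲ(Z;ℚ)) = dim_ℂ Hom_ℂ(Hᵃ(Z;ℂ), Hⁱ(Y;ℂ))`** (`i + j = 2c`, `a + j = 2 dim Z`): with §1/§4 and the seat's g30-#2 (`t ↦ (crossMap t ⊗ 1)_*` injective, ℚ-independent ↦
ℂ-independent) the rational summand is a `ℚ`-form of the Hom space. [cite: VoisinHodgeI2002, §11.3.3 Lemma 11.41 and p. 286] [cite: HatcherAT2002, §3.3 Cor. 3.37 and §3.A Cor. 3A.6] -/
theorem BettiUniverse.finrank_tensor_eq_finrank_hom_complexBetti (hY : IsSmoothProjective m Y) (hZ : IsSmoothProjective n Z) {c i j a : ℕ} (hij : i + j = 2 * c) (haj : a + j = 2 * n) :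
    Module.finrank ℚ (bettiCohomology Y i ⊗[ℚ] bettiCohomology Z j) = Module.finrank ℂ (complexBetti Z a →ₗ[ℂ] complexBetti Y i) := by
  rw [finrank_hom_complexBetti_eq_finrank_kunnethPiece hY hZ hij haj, BettiUniverse.finrank_kunnethPiece_eq_finrank_tensor hY hZ hij]

end Action

end Literature.AlgebraicGeometry.HodgeTheory

end
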